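import Mathlib
import Summits.KontsevichZagierPeriods.Zeta5Search.SecondResidueLaw
import HarnessLib

/-!
# Decidable mirrors of the class data (depth by inequalities) and `Decidable` instances for the frame clauses

HONEST FRAMING: systematic search; no irrationality claim unless certified.

The class-structure statements `RecordWindowsA4.LawA4Classes b p M T`, `SecondResidueLaw.ShapeClause b p M T` and
`SecondResidueLaw.RecFrameL5 n p M T` are finite Boolean conditions on the class data of `(b, p)`, but `decide` cannot evaluate them
as defined: `blockCount` tests membership in the blocks `Finset.Icc β (b₀ − β)`, whose decision procedure ENUMERATES the interval
(≈ `b₀` steps per test; REPORT-gen2-g15 §7: one `classExp (bRec 44) 43 x` costs ≈ 20 s in the kernel, one clause does not finish).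

This file gives MIRRORS `blockCountD`, `netExpD`, `classSetD` (the residue class as an arithmetic progression, no scan of `0..b₀`),
`classExpD`, `classPoleCountD`, `multipoleClassesD`, `tameSingleD`, `classNuD`, `classTypeListD` in which the depth is computed by the
`14` comparisons `β_j ≤ q ≤ b₀ − β_j`, proves them EQUAL to the originals (`*_eq`, by `Finset.mem_Icc` and the progression lemma
`classSetD_eq`), restates the clauses over the mirrors (`LawA4ClassesD`, `ShapeClauseD`, `↔` the originals) and registers `Decidable`
instances for `LawA4Classes`, `ShapeClause`, `RecFrameL5` (§1–§2).  §3 is the CERTIFICATE layer the instance files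
`RecFrameL5M56/M52/M48.lean` use: the raise predicates `isRaise2 T S` / `isRaiseN 3 T S` enumerate thousands of candidate lists and
are NOT kernel-evaluated; instead `LawA4CertD` / `ShapeCertD` check that the type lists of the relevant classes lie in a short
witness list `W` (decidable, cheap), and `lawA4Classes_of_cert` / `shapeClause_of_cert` discharge `W` by explicit raise chains
(`isRaise2_of_*`, `isRaiseN_succ_of_*`).  No mathematics beyond bookkeeping.
-/

open Finset

namespace Summit.KontsevichZagierPeriods.Zeta5Search.ClassDecide

open Summit.KontsevichZagierPeriods.Zeta5Search.ClusterValuation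
open Summit.KontsevichZagierPeriods.Zeta5Search.CasoratianValuation (shift)
open Summit.KontsevichZagierPeriods.Zeta5Search.BigPrime (block)
open Summit.KontsevichZagierPeriods.Zeta5Search.SecondOrder (classTypeList isRaise isRaise2 raiseAtList topLevel)
open Summit.KontsevichZagierPeriods.Zeta5Search.RecordWindowsA4 (LawA4Classes)
open Summit.KontsevichZagierPeriods.Zeta5Search.SecondResidueLaw (isRaiseN ShapeClause RecFrameL5)

/-! ## §1 Mirrors of the class data -/

/-- Depth of `q` by the `14` comparisons `β_j ≤ q ≤ b₀ − β_j`. -/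
def blockCountD (b : ℕ → ℤ) (q : ℕ) : ℕ :=
  ((range 7).filter fun j => (b (j + 1)).toNat ≤ q ∧ q ≤ (b 0).toNat - (b (j + 1)).toNat).card

/-- `blockCountD = blockCount`. -/
theorem blockCountD_eq : blockCountD = blockCount := by
  funext b q
  unfold blockCountD blockCount
  congr 1
  ext j
  simp only [mem_filter, block, mem_Icc]

/-- Net exponent through `blockCountD`. -/
def netExpD (b : ℕ → ℤ) (q : ℕ) : ℤ :=
  1 - (blockCountD b q : ℤ) + (if 2 * (q : ℤ) = b 0 then 1 else 0)

/-- `netExpD = netExp`. -/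
theorem netExpD_eq : netExpD = netExp := by
  funext b q
  simp only [netExpD, netExp, blockCountD_eq]

/-- The residue class of `x` among `0..b₀` as the ARITHMETIC PROGRESSION `x % p, x % p + p, …` (no scan of `0..b₀`); falls back to
`classSet` off the meaningful range `0 < p`, `x % p ≤ b₀`. -/
def classSetD (b : ℕ → ℤ) (p x : ℕ) : Finset ℕ :=
  if h : 0 < p ∧ x % p ≤ (b 0).toNat then
    (range (((b 0).toNat - x % p) / p + 1)).map
      ⟨fun ℓ => x % p + ℓ * p, fun _ _ hac => Nat.eq_of_mul_eq_mul_right h.1 (Nat.add_left_cancel hac)⟩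
  else classSet b p x

/-- `classSetD = classSet`. -/
theorem classSetD_eq : classSetD = classSet := by
  funext b p x
  unfold classSetD
  split_ifs with h
  · obtain ⟨hp, hx⟩ := h
    ext s
    simp only [Finset.mem_map, Finset.mem_range, Function.Embedding.coeFn_mk, classSet, Finset.mem_filter]
    constructor
    · rintro ⟨ℓ, hℓ, rfl⟩
      have h1 : ℓ * p ≤ (b 0).toNat - x % p := (Nat.le_div_iff_mul_le hp).1 (Nat.lt_succ_iff.1 hℓ)
      refine ⟨?_, ?_⟩
      · have := (Nat.le_sub_iff_add_le hx).1 h1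
        omega
      · rw [Nat.add_mul_mod_self_right, Nat.mod_mod]
    · rintro ⟨hs, hmod⟩
      have hsd : x % p + p * (s / p) = s := by rw [← hmod]; exact Nat.mod_add_div s p
      refine ⟨s / p, ?_, ?_⟩
      · rw [Nat.lt_succ_iff, Nat.le_div_iff_mul_le hp]
        apply Nat.le_sub_of_add_le
        rw [Nat.mul_comm, add_comm, hsd]
        exact Nat.lt_succ_iff.1 hs
      · rw [Nat.mul_comm]; exact hsd
  · rfl

/-- Class exponent through `netExpD` and `classSetD`. -/
def classExpD (b : ℕ → ℤ) (p x : ℕ) : ℤ :=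
  (∑ s ∈ classSetD b p x, netExpD b s) + (if ¬ (2 : ℤ) ∣ b 0 ∧ CentreIn b p x then 1 else 0)

/-- `classExpD = classExp`. -/
theorem classExpD_eq : classExpD = classExp := by
  funext b p x
  simp only [classExpD, classExp, netExpD_eq, classSetD_eq]

/-- Pole count through `netExpD` and `classSetD`. -/
def classPoleCountD (b : ℕ → ℤ) (p x : ℕ) : ℕ := ((classSetD b p x).filter fun s => netExpD b s < 0).card

/-- `classPoleCountD = classPoleCount`. -/
theorem classPoleCountD_eq : classPoleCountD = classPoleCount := by
  funext b p x
  simp only [classPoleCountD, classPoleCount, netExpD_eq, classSetD_eq]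

/-- Multipole classes through `classPoleCountD`. -/
def multipoleClassesD (b : ℕ → ℤ) (p : ℕ) : Finset ℕ := (range p).filter fun x => 2 ≤ classPoleCountD b p x

/-- `multipoleClassesD = multipoleClasses`. -/
theorem multipoleClassesD_eq : multipoleClassesD = multipoleClasses := by
  funext b p
  simp only [multipoleClassesD, multipoleClasses, classPoleCountD_eq]

/-- Tameness test through `netExpD`. -/
def tameSingleD (b : ℕ → ℤ) (p x : ℕ) : Bool :=
  decide (∃ q ∈ classSetD b p x, netExpD b q < 0 ∧ (q < p ∨ ∀ s ∈ classSetD b p x, s < q → 0 < netExpD b s))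

/-- `tameSingleD = tameSingle`. -/
theorem tameSingleD_eq : tameSingleD = tameSingle := by
  funext b p x
  unfold tameSingleD tameSingle
  rw [netExpD_eq, classSetD_eq]

/-- `ν_x` through the mirrors. -/
def classNuD (b : ℕ → ℤ) (p x : ℕ) : ℤ :=
  if classPoleCountD b p x = 1 ∧ tameSingleD b p x = true then max (classExpD b p x) 0 else classExpD b p x

/-- `classNuD = classNu`. -/
theorem classNuD_eq : classNuD = classNu := by
  funext b p x
  unfold classNuD classNu
  rw [classPoleCountD_eq, tameSingleD_eq, classExpD_eq]

/-- Type list through `netExpD`. -/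
def classTypeListD (b : ℕ → ℤ) (p x : ℕ) : List ℤ :=
  (List.range (topLevel b p x + 1)).map fun ℓ => netExpD b (x + ℓ * p)

/-- `classTypeListD = classTypeList`. -/
theorem classTypeListD_eq : classTypeListD = classTypeList := by
  funext b p x
  simp only [classTypeListD, classTypeList, netExpD_eq]

/-! ## §2 The clauses over the mirrors and the `Decidable` instances -/

/-- `LawA4Classes` restated over the mirrors. -/
def LawA4ClassesD (b : ℕ → ℤ) (p M : ℕ) (T : List ℤ) : Prop :=
  (∀ x ∈ multipoleClassesD b p, -(M : ℤ) ≤ classExpD b p x) ∧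
  (∀ y, y < p → classPoleCountD b p y = 1 → -(M : ℤ) + 1 ≤ classNuD b p y) ∧
  (∀ x ∈ multipoleClassesD b p, classExpD b p x = -(M : ℤ) → ¬ CentreIn b p x ∧ classTypeListD b p x = T) ∧
  (∀ y, y < p → 1 ≤ classPoleCountD b p y → classNuD b p y = -(M : ℤ) + 1 →
      isRaise T (classTypeListD b p y) = true ∨ (¬ (2 : ℤ) ∣ b 0 ∧ CentreIn b p y ∧ classTypeListD b p y = T)) ∧
  (∀ z, z < p → 1 ≤ classPoleCountD b p z → classNuD b p z = -(M : ℤ) + 2 → isRaise2 T (classTypeListD b p z) = true)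

/-- `LawA4ClassesD ↔ LawA4Classes`. -/
theorem lawA4ClassesD_iff (b : ℕ → ℤ) (p M : ℕ) (T : List ℤ) : LawA4ClassesD b p M T ↔ LawA4Classes b p M T := by
  unfold LawA4ClassesD LawA4Classes
  rw [multipoleClassesD_eq, classExpD_eq, classPoleCountD_eq, classNuD_eq, classTypeListD_eq]

/-- `ShapeClause` restated over the mirrors. -/
def ShapeClauseD (b : ℕ → ℤ) (p M : ℕ) (T : List ℤ) : Prop :=
  ∀ z, z < p → 1 ≤ classPoleCountD b p z → classNuD b p z = -(M : ℤ) + 3 →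
    isRaiseN 3 T (classTypeListD b p z) = true ∨ (¬ (2 : ℤ) ∣ b 0 ∧ CentreIn b p z ∧ isRaiseN 2 T (classTypeListD b p z) = true)

/-- `ShapeClauseD ↔ ShapeClause`. -/
theorem shapeClauseD_iff (b : ℕ → ℤ) (p M : ℕ) (T : List ℤ) : ShapeClauseD b p M T ↔ ShapeClause b p M T := by
  unfold ShapeClauseD ShapeClause
  rw [classPoleCountD_eq, classNuD_eq, classTypeListD_eq]

/-- The mirror clauses are decidable by evaluation. -/
instance decLawA4ClassesD (b : ℕ → ℤ) (p M : ℕ) (T : List ℤ) : Decidable (LawA4ClassesD b p M T) := by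
  unfold LawA4ClassesD
  refine @instDecidableAnd _ _ ?_ (@instDecidableAnd _ _ ?_ (@instDecidableAnd _ _ ?_ (@instDecidableAnd _ _ ?_ ?_))) <;>
    infer_instance

/-- The mirror shape clause is decidable by evaluation. -/
instance decShapeClauseD (b : ℕ → ℤ) (p M : ℕ) (T : List ℤ) : Decidable (ShapeClauseD b p M T) := by
  unfold ShapeClauseD; infer_instance

/-- **`LawA4Classes b p M T` is decidable** (through the mirror). -/
instance decLawA4Classes (b : ℕ → ℤ) (p M : ℕ) (T : List ℤ) : Decidable (LawA4Classes b p M T) :=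
  decidable_of_iff _ (lawA4ClassesD_iff b p M T)

/-- **`ShapeClause b p M T` is decidable** (through the mirror). -/
instance decShapeClause (b : ℕ → ℤ) (p M : ℕ) (T : List ℤ) : Decidable (ShapeClause b p M T) :=
  decidable_of_iff _ (shapeClauseD_iff b p M T)

/-- **`RecFrameL5 n p M T` is decidable.** -/
instance decRecFrameL5 (n p M : ℕ) (T : List ℤ) : Decidable (RecFrameL5 n p M T) := by
  unfold RecFrameL5; infer_instance

/-! ## §3 Certificates: the raise predicates by explicit witnesses

`decide` must not evaluate `isRaise2` / `isRaiseN 3` themselves (they enumerate all candidate shapes: thousands of `List.mapIdx` images, too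
much for the kernel); instead an instance supplies, per frame, the short list `W` of type lists that occur, `decide` checks MEMBERSHIP in `W`,
and each member of `W` is shown to be a raise / T-shape by an explicit chain of single raises (`isRaise2_of_*`, `isRaiseN_succ_of_*`). -/

/-- Two raises at levels of `T` form an admissible double raise. -/
theorem isRaise2_of_raise_raise (T : List ℤ) {a c : ℕ} (ha : a < T.length) (hc : c < T.length) :
    isRaise2 T (raiseAtList (raiseAtList T a) c) = true := by
  have h : ((List.range T.length).any fun a' => (List.range T.length).any fun c' =>
      raiseAtList (raiseAtList T a) c == raiseAtList (raiseAtList T a') c') = true := by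
    rw [List.any_eq_true]
    refine ⟨a, List.mem_range.2 ha, ?_⟩
    rw [List.any_eq_true]
    exact ⟨c, List.mem_range.2 hc, beq_self_eq_true _⟩
  simp only [isRaise2, h, Bool.true_or]

/-- A raise at a level of `T` plus a new lower end entry `1`. -/
theorem isRaise2_of_cons_raise (T : List ℤ) {a : ℕ} (ha : a < T.length) : isRaise2 T (1 :: raiseAtList T a) = true := by
  have h : ((List.range T.length).any fun a' =>
      1 :: raiseAtList T a == 1 :: raiseAtList T a' || 1 :: raiseAtList T a == raiseAtList T a' ++ [1]) = true := by
    rw [List.any_eq_true]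
    exact ⟨a, List.mem_range.2 ha, by simp only [beq_self_eq_true, Bool.true_or]⟩
  simp only [isRaise2, h, Bool.true_or, Bool.or_true]

/-- A raise at a level of `T` plus a new upper end entry `1`. -/
theorem isRaise2_of_raise_append (T : List ℤ) {a : ℕ} (ha : a < T.length) : isRaise2 T (raiseAtList T a ++ [1]) = true := by
  have h : ((List.range T.length).any fun a' =>
      raiseAtList T a ++ [1] == 1 :: raiseAtList T a' || raiseAtList T a ++ [1] == raiseAtList T a' ++ [1]) = true := by
    rw [List.any_eq_true]
    exact ⟨a, List.mem_range.2 ha, by simp only [beq_self_eq_true, Bool.or_true]⟩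
  simp only [isRaise2, h, Bool.true_or, Bool.or_true]

/-- A new lower end entry `2`. -/
theorem isRaise2_cons_two (T : List ℤ) : isRaise2 T (2 :: T) = true := by
  simp only [isRaise2, beq_self_eq_true, Bool.true_or, Bool.or_true]

/-- A new upper end entry `2`. -/
theorem isRaise2_append_two (T : List ℤ) : isRaise2 T (T ++ [2]) = true := by
  simp only [isRaise2, beq_self_eq_true, Bool.true_or, Bool.or_true]

/-- Both new end entries `1`. -/
theorem isRaise2_cons_append (T : List ℤ) : isRaise2 T (1 :: (T ++ [1])) = true := by
  simp only [isRaise2, beq_self_eq_true, Bool.or_true]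

/-- Degree `0`: `T` is a T-shape of itself. -/
theorem isRaiseN_zero_refl (T : List ℤ) : isRaiseN 0 T T = true := by
  simp only [isRaiseN, beq_self_eq_true]

/-- One more raise through an explicit member of the candidate list. -/
theorem isRaiseN_succ_of_mem (k : ℕ) (T S U : List ℤ)
    (hU : U ∈ ((List.range T.length).map fun i => raiseAtList T i) ++ [1 :: T, T ++ [1]])
    (h : isRaiseN k U S = true) : isRaiseN (k + 1) T S = true := by
  rw [isRaiseN, List.any_eq_true]
  exact ⟨U, hU, h⟩

/-- One more raise at a level `a` of `T`. -/
theorem isRaiseN_succ_of_raise (k : ℕ) (T S : List ℤ) {a : ℕ} (ha : a < T.length)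
    (h : isRaiseN k (raiseAtList T a) S = true) : isRaiseN (k + 1) T S = true :=
  isRaiseN_succ_of_mem k T S _ (List.mem_append.2 (Or.inl (List.mem_map.2 ⟨a, List.mem_range.2 ha, rfl⟩))) h

/-- One more raise: a new lower end entry `1`. -/
theorem isRaiseN_succ_of_cons (k : ℕ) (T S : List ℤ) (h : isRaiseN k (1 :: T) S = true) : isRaiseN (k + 1) T S = true :=
  isRaiseN_succ_of_mem k T S _ (List.mem_append.2 (Or.inr (by simp))) h

/-- One more raise: a new upper end entry `1`. -/
theorem isRaiseN_succ_of_append (k : ℕ) (T S : List ℤ) (h : isRaiseN k (T ++ [1]) S = true) : isRaiseN (k + 1) T S = true :=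
  isRaiseN_succ_of_mem k T S _ (List.mem_append.2 (Or.inr (by simp))) h

/-- CERTIFICATE FORM of `LawA4Classes`: clauses 1–4 over the mirrors, clause 5 as membership of the type list in a witness list `W`. -/
def LawA4CertD (b : ℕ → ℤ) (p M : ℕ) (T : List ℤ) (W : List (List ℤ)) : Prop :=
  (∀ x ∈ multipoleClassesD b p, -(M : ℤ) ≤ classExpD b p x) ∧
  (∀ y, y < p → classPoleCountD b p y = 1 → -(M : ℤ) + 1 ≤ classNuD b p y) ∧
  (∀ x ∈ multipoleClassesD b p, classExpD b p x = -(M : ℤ) → ¬ CentreIn b p x ∧ classTypeListD b p x = T) ∧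
  (∀ y, y < p → 1 ≤ classPoleCountD b p y → classNuD b p y = -(M : ℤ) + 1 →
      isRaise T (classTypeListD b p y) = true ∨ (¬ (2 : ℤ) ∣ b 0 ∧ CentreIn b p y ∧ classTypeListD b p y = T)) ∧
  (∀ z, z < p → 1 ≤ classPoleCountD b p z → classNuD b p z = -(M : ℤ) + 2 → classTypeListD b p z ∈ W)

/-- The certificate is decidable by evaluation. -/
instance decLawA4CertD (b : ℕ → ℤ) (p M : ℕ) (T : List ℤ) (W : List (List ℤ)) : Decidable (LawA4CertD b p M T W) := by
  unfold LawA4CertD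
  refine @instDecidableAnd _ _ ?_ (@instDecidableAnd _ _ ?_ (@instDecidableAnd _ _ ?_ (@instDecidableAnd _ _ ?_ ?_))) <;>
    infer_instance

/-- **`LawA4Classes` from a certificate** whose witness lists are admissible double raises. -/
theorem lawA4Classes_of_cert (b : ℕ → ℤ) (p M : ℕ) (T : List ℤ) (W : List (List ℤ)) (h : LawA4CertD b p M T W)
    (hW : ∀ S ∈ W, isRaise2 T S = true) : LawA4Classes b p M T := by
  obtain ⟨c1, c2, c3, c4, c5⟩ := h
  exact (lawA4ClassesD_iff b p M T).1 ⟨c1, c2, c3, c4, fun z hz h1 h2 => hW _ (c5 z hz h1 h2)⟩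

/-- CERTIFICATE FORM of the shape clause: membership of the type list in witness lists `W₃` (degree-3 shapes) / `W₂` (odd-centre classes). -/
def ShapeCertD (b : ℕ → ℤ) (p M : ℕ) (W₃ W₂ : List (List ℤ)) : Prop :=
  ∀ z, z < p → 1 ≤ classPoleCountD b p z → classNuD b p z = -(M : ℤ) + 3 →
    classTypeListD b p z ∈ W₃ ∨ (¬ (2 : ℤ) ∣ b 0 ∧ CentreIn b p z ∧ classTypeListD b p z ∈ W₂)

/-- The shape certificate is decidable by evaluation (through the `List.range` form of the bounded quantifier). -/
instance decShapeCertD (b : ℕ → ℤ) (p M : ℕ) (W₃ W₂ : List (List ℤ)) : Decidable (ShapeCertD b p M W₃ W₂) :=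
  decidable_of_iff (∀ z ∈ List.range p, 1 ≤ classPoleCountD b p z → classNuD b p z = -(M : ℤ) + 3 →
      classTypeListD b p z ∈ W₃ ∨ (¬ (2 : ℤ) ∣ b 0 ∧ CentreIn b p z ∧ classTypeListD b p z ∈ W₂))
    (by simp only [ShapeCertD, List.mem_range])

/-- **`ShapeClause` from a certificate** whose witness lists are T-shapes of degree `3` / `2`. -/
theorem shapeClause_of_cert (b : ℕ → ℤ) (p M : ℕ) (T : List ℤ) (W₃ W₂ : List (List ℤ)) (h : ShapeCertD b p M W₃ W₂)
    (h3 : ∀ S ∈ W₃, isRaiseN 3 T S = true) (h2 : ∀ S ∈ W₂, isRaiseN 2 T S = true) : ShapeClause b p M T :=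
  (shapeClauseD_iff b p M T).1 fun z hz h1 hν =>
    (h z hz h1 hν).elim (fun hm => Or.inl (h3 _ hm)) (fun hm => Or.inr ⟨hm.1, hm.2.1, h2 _ hm.2.2⟩)

end Summit.KontsevichZagierPeriods.Zeta5Search.ClassDecide
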